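import Summits.HodgeConjecture.CorCM.AbelianTwoPowerSubgroupInduction
import Mathlib.GroupTheory.SpecificGroups.Dihedral
import Mathlib.GroupTheory.SpecificGroups.Quaternion
import HarnessLib

/-!
# Non-abelian Galois CM fields of degree `16`: composita of a totally real `D₄`- or `Q₈`-octic field with an
# imaginary quadratic field carry simple DEGENERATE CM abelian eightfolds

COR-CM (cell `pub-hodgecm2`), binder seat b04 (gen 16), count-neutral claim GALOIS16-NONAB-DEGENERATE (a sequel note to
ABELIAN-2POWER-NECESSITY).  KERNEL ONLY: theorems; no definition, no named fact, no `sorry`.  `HC_CM` is neither used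
nor claimed.

Part I's dictionary `SubgroupInduction.exists_isPrimitive_not_isNondegenerate_of_galoisFinset` needs NO commutativity:
for a Galois CM field `K` with ARBITRARY finite Galois group, a CM set `T ⊆ Gal(K/ℚ)` with trivial left stabiliser,
balanced over the right cosets of a subgroup avoiding complex conjugation, is a PRIMITIVE DEGENERATE CM type.

* §1 `exists_isPrimitive_not_isNondegenerate_of_mulModel` — the dictionary for an ISOMORPHISM `e : Gal(K/ℚ) ≃ G₀`
  with a concrete finite group, a kernel-decided model `T₀ ⊆ G₀` (CM set for `c₀ = e(c)`, trivial left stabiliser)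
  balanced over the fibres of a homomorphism `f : G₀ → N₀` with `f(c₀) ≠ 1`.
* §2 models (by `decide`) on `D₄ × C₂` (Mathlib `DihedralGroup 4 × Multiplicative (ZMod 2)`) and `Q₈ × C₂`
  (`QuaternionGroup 2 × Multiplicative (ZMod 2)`) with `c₀` the generator of the `C₂` factor and `f` the second
  projection: Weil type `(4,4)` over the imaginary quadratic subfield `K^{D₄ × 1}` resp. `K^{Q₈ × 1}`.
* §3 **`exists_simple_degenerate_of_equiv_dihedral_prod`**, **`exists_simple_degenerate_of_equiv_quaternion_prod`**:
  a Galois CM field `K` of degree `16` with `Gal(K/ℚ) ≅ D₄ × C₂` resp. `Q₈ × C₂`, complex conjugation generating the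
  `C₂` factor — i.e. `K = F·k` with `F = K⁺` a totally real Galois octic field with group `D₄` resp. `Q₈` and `k` an
  imaginary quadratic field — has a PRIMITIVE DEGENERATE CM type, realised by a SIMPLE CM abelian eightfold with an
  exceptional Hodge class on some power.

Group-level census of this seat (`scratch/nonab16/census16.py`; all nine non-abelian groups of order `16`, all central
involutions; primitive = trivial left stabiliser, rank = rank of the right translates): GOOD (every primitive type
nondegenerate) — `D₁₆`, `Q₁₆`, `C₄ ∘ D₄`, `D₄ × C₂` and `Q₈ × C₂` with `c` the square central involution; BAD —
`SD₁₆` (64 primitive degenerate types, NONE of Weil type over a subfield), `M₁₆` (32, none of Weil type), `C₄ ⋊ C₄`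
(all three `c`), `(C₄ × C₂) ⋊ C₂` (all three `c`), `D₄ × C₂` and `Q₈ × C₂` with `c ∉ (D₄ resp. Q₈) × 1` (this file).
The good half and the non-Weil degenerate types of `SD₁₆`, `M₁₆` need rank certificates for non-abelian Galois
groups and are left open here.

## References

* [Shimura1998] G. Shimura, *Abelian Varieties with Complex Multiplication and Modular Functions*, §6.2 Thm. 3,
  §8.1, §8.2 Prop. 26.
* [Gordon1999HodgeAVSurvey] B. B. Gordon, *A survey of the Hodge conjecture for abelian varieties*, §9.4.3
  (Theorem [B.140] = Yanai 1994), Thm. 6.4.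
* [Dodson1984] B. Dodson, *The structure of Galois groups of CM-fields*, Trans. AMS 283 (1984), §3.3, §5.2.
-/

noncomputable section

open CategoryTheory CategoryTheory.Limits NumberField

namespace Summit.HodgeConjecture.CorCM.GaloisSixteenNonabelian

open Literature.NumberTheory.ComplexMultiplication
open Literature.AlgebraicGeometry.Motives (AbelianVariety CMType)
open Literature.AlgebraicGeometry.HodgeTheory
open Literature.AlgebraicGeometry.ComplexMultiplication (IsCMTypeRealisation isSimple_iff_isPrimitive)
open Literature.AlgebraicGeometry.Pohlmann1968
open Literature.Barriers.HodgeConjecture (divisorClassesSpan)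
open Summit.HodgeConjecture.CorCM.SubgroupInduction (exists_isPrimitive_not_isNondegenerate_of_galoisFinset)
open Summit.HodgeConjecture.CorCM.AbelianSixteen (exists_simple_realisation_of_isPrimitive)

open scoped Classical

variable {K : Type} [Field K] [NumberField K] [IsCMField K]

/-! ## §1 The dictionary for an isomorphism with a concrete (possibly non-abelian) group -/

/-- **Models on a concrete group isomorphic to `Gal(K/ℚ)` give primitive degenerate CM types** (no commutativity).
`e : Gal(K/ℚ) ≃ G₀`, `c₀ = e(c)`; `T₀ ⊆ G₀` with `x ∈ T₀ ↔ c₀ x ∉ T₀` and trivial left stabiliser; `f : G₀ → N₀` a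
homomorphism with `f(c₀) ≠ 1` over whose fibres `T₀` is balanced.  Then `K` has a PRIMITIVE CM type which is
balanced over the fixed field of `ker(f ∘ e)` (a subfield with a complex place), hence DEGENERATE (Yanai, `a = b`).
[cite: Gordon1999HodgeAVSurvey, §9.4.3 (Theorem [B.140])] [cite: Shimura1998, §8.1, §8.2 Prop. 26] -/
theorem exists_isPrimitive_not_isNondegenerate_of_mulModel [IsGalois ℚ K] {G₀ N₀ : Type*} [Group G₀]
    [Fintype G₀] [DecidableEq G₀] [Group N₀] [DecidableEq N₀] (e : (K ≃ₐ[ℚ] K) ≃* G₀) (c₀ : G₀)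
    (hc : e ((IsCMField.complexConj K).restrictScalars ℚ) = c₀) (T₀ : Finset G₀)
    (hcm : ∀ x : G₀, x ∈ T₀ ↔ c₀ * x ∉ T₀) (hprim : ∀ v : G₀, v ≠ 1 → ∃ w : G₀, ¬ (w ∈ T₀ ↔ v * w ∈ T₀))
    (f : G₀ →* N₀) (hfc : f c₀ ≠ 1)
    (hbal : ∀ x : G₀, (Finset.univ.filter fun h : G₀ => f h = f x ∧ h ∈ T₀).card =
      (Finset.univ.filter fun h : G₀ => f h = f x ∧ h ∉ T₀).card) (φ₀ : K →+* ℂ) :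
    ∃ Φ : CMType K, IsPrimitive (ℂ ≃+* ℂ) Φ.1 φ₀ ∧ ¬ IsNondegenerate Φ := by
  set c : K ≃ₐ[ℚ] K := (IsCMField.complexConj K).restrictScalars ℚ with hc_def
  -- pull the model back along `e`
  set T : Finset (K ≃ₐ[ℚ] K) := Finset.univ.filter fun g => e g ∈ T₀ with hT
  have hmemT : ∀ g, g ∈ T ↔ e g ∈ T₀ := fun g => by simp only [hT, Finset.mem_filter, Finset.mem_univ, true_and]
  set H : Subgroup (K ≃ₐ[ℚ] K) := (f.comp e.toMonoidHom).ker with hH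
  have hmemH : ∀ g, g ∈ H ↔ f (e g) = 1 := fun g => by rw [hH, MonoidHom.mem_ker]; rfl
  have hcmT : ∀ g, g ∈ T ↔ c * g ∉ T := fun g => by rw [hmemT, hmemT, map_mul, hc]; exact hcm (e g)
  have hprimT : ∀ v : K ≃ₐ[ℚ] K, v ≠ 1 → ∃ w, ¬ (w ∈ T ↔ v * w ∈ T) := by
    intro v hv
    have hv' : e v ≠ 1 := fun h => hv (e.injective (by rw [h, map_one]))
    obtain ⟨w₀, hw₀⟩ := hprim (e v) hv'
    refine ⟨e.symm w₀, fun h => hw₀ ?_⟩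
    rwa [hmemT, hmemT, map_mul, MulEquiv.apply_symm_apply] at h
  have hcH : c ∉ H := by rw [hmemH, hc]; exact hfc
  have hbalT : ∀ g₀ : K ≃ₐ[ℚ] K, {g | g₀ * g⁻¹ ∈ H ∧ g ∈ T}.ncard = {g | g₀ * g⁻¹ ∈ H ∧ g ∉ T}.ncard := by
    intro g₀
    have hfib : ∀ p : Prop, {g : K ≃ₐ[ℚ] K | g₀ * g⁻¹ ∈ H ∧ (g ∈ T ↔ p)} =
        e.symm '' ↑(Finset.univ.filter fun h : G₀ => f h = f (e g₀) ∧ (h ∈ T₀ ↔ p)) := by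
      intro p
      ext g
      simp only [Set.mem_setOf_eq, Set.mem_image, Finset.coe_filter, Finset.mem_univ, true_and]
      constructor
      · rintro ⟨hg, hp⟩
        refine ⟨e g, ⟨?_, by rwa [hmemT] at hp⟩, e.symm_apply_apply g⟩
        rw [hmemH, map_mul, map_inv, map_mul, map_inv, mul_inv_eq_one] at hg
        exact hg.symm
      · rintro ⟨x, ⟨hx, hp⟩, rfl⟩
        refine ⟨?_, by rwa [hmemT, MulEquiv.apply_symm_apply]⟩
        rw [hmemH, map_mul, map_inv, map_mul, map_inv, MulEquiv.apply_symm_apply, mul_inv_eq_one]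
        exact hx.symm
    rw [show {g : K ≃ₐ[ℚ] K | g₀ * g⁻¹ ∈ H ∧ g ∈ T} = {g | g₀ * g⁻¹ ∈ H ∧ (g ∈ T ↔ True)} by
        simp only [iff_true],
      show {g : K ≃ₐ[ℚ] K | g₀ * g⁻¹ ∈ H ∧ g ∉ T} = {g | g₀ * g⁻¹ ∈ H ∧ (g ∈ T ↔ False)} by
        simp only [iff_false],
      hfib, hfib, Set.ncard_image_of_injective _ e.symm.injective,
      Set.ncard_image_of_injective _ e.symm.injective, Set.ncard_coe_finset, Set.ncard_coe_finset]
    convert hbal (e g₀) using 3 <;> simp only [iff_true, iff_false]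
  obtain ⟨Φ, hΦ, hdeg, -⟩ := exists_isPrimitive_not_isNondegenerate_of_galoisFinset T hcmT hprimT H hcH hbalT φ₀
  exact ⟨Φ, hΦ, hdeg⟩

/-! ## §2 Two kernel-decided models -/

namespace Models

open DihedralGroup in
/-- `D₄ × C₂`, `c₀ = (1, z)`: CM set. [folklore] -/
theorem cm_d4 : ∀ x : DihedralGroup 4 × Multiplicative (ZMod 2),
    x ∈ ({(r 0, Multiplicative.ofAdd 0), (r 1, Multiplicative.ofAdd 1), (r 2, Multiplicative.ofAdd 0),
      (r 3, Multiplicative.ofAdd 1), (sr 0, Multiplicative.ofAdd 0), (sr 1, Multiplicative.ofAdd 0),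
      (sr 2, Multiplicative.ofAdd 1), (sr 3, Multiplicative.ofAdd 1)} :
      Finset (DihedralGroup 4 × Multiplicative (ZMod 2))) ↔
    (r 0, Multiplicative.ofAdd 1) * x ∉ ({(r 0, Multiplicative.ofAdd 0), (r 1, Multiplicative.ofAdd 1),
      (r 2, Multiplicative.ofAdd 0), (r 3, Multiplicative.ofAdd 1), (sr 0, Multiplicative.ofAdd 0),
      (sr 1, Multiplicative.ofAdd 0), (sr 2, Multiplicative.ofAdd 1), (sr 3, Multiplicative.ofAdd 1)} :
      Finset (DihedralGroup 4 × Multiplicative (ZMod 2))) := by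
  decide

open DihedralGroup in
/-- `D₄ × C₂`, `c₀ = (1, z)`: trivial left stabiliser. [folklore] -/
theorem prim_d4 : ∀ v : DihedralGroup 4 × Multiplicative (ZMod 2), v ≠ 1 →
    ∃ w : DihedralGroup 4 × Multiplicative (ZMod 2),
    ¬ (w ∈ ({(r 0, Multiplicative.ofAdd 0), (r 1, Multiplicative.ofAdd 1), (r 2, Multiplicative.ofAdd 0),
      (r 3, Multiplicative.ofAdd 1), (sr 0, Multiplicative.ofAdd 0), (sr 1, Multiplicative.ofAdd 0),
      (sr 2, Multiplicative.ofAdd 1), (sr 3, Multiplicative.ofAdd 1)} :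
      Finset (DihedralGroup 4 × Multiplicative (ZMod 2))) ↔
      v * w ∈ ({(r 0, Multiplicative.ofAdd 0), (r 1, Multiplicative.ofAdd 1), (r 2, Multiplicative.ofAdd 0),
      (r 3, Multiplicative.ofAdd 1), (sr 0, Multiplicative.ofAdd 0), (sr 1, Multiplicative.ofAdd 0),
      (sr 2, Multiplicative.ofAdd 1), (sr 3, Multiplicative.ofAdd 1)} :
      Finset (DihedralGroup 4 × Multiplicative (ZMod 2)))) := by
  decide

open DihedralGroup in
/-- `D₄ × C₂`, `c₀ = (1, z)`: Weil type `(4,4)` over the fibres of the second projection. [folklore] -/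
theorem bal_d4 : ∀ x : DihedralGroup 4 × Multiplicative (ZMod 2),
    (Finset.univ.filter fun h : DihedralGroup 4 × Multiplicative (ZMod 2) =>
      (MonoidHom.snd (DihedralGroup 4) (Multiplicative (ZMod 2))) h =
        (MonoidHom.snd (DihedralGroup 4) (Multiplicative (ZMod 2))) x ∧
      h ∈ ({(r 0, Multiplicative.ofAdd 0), (r 1, Multiplicative.ofAdd 1), (r 2, Multiplicative.ofAdd 0),
      (r 3, Multiplicative.ofAdd 1), (sr 0, Multiplicative.ofAdd 0), (sr 1, Multiplicative.ofAdd 0),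
      (sr 2, Multiplicative.ofAdd 1), (sr 3, Multiplicative.ofAdd 1)} :
      Finset (DihedralGroup 4 × Multiplicative (ZMod 2)))).card =
    (Finset.univ.filter fun h : DihedralGroup 4 × Multiplicative (ZMod 2) =>
      (MonoidHom.snd (DihedralGroup 4) (Multiplicative (ZMod 2))) h =
        (MonoidHom.snd (DihedralGroup 4) (Multiplicative (ZMod 2))) x ∧
      h ∉ ({(r 0, Multiplicative.ofAdd 0), (r 1, Multiplicative.ofAdd 1), (r 2, Multiplicative.ofAdd 0),
      (r 3, Multiplicative.ofAdd 1), (sr 0, Multiplicative.ofAdd 0), (sr 1, Multiplicative.ofAdd 0),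
      (sr 2, Multiplicative.ofAdd 1), (sr 3, Multiplicative.ofAdd 1)} :
      Finset (DihedralGroup 4 × Multiplicative (ZMod 2)))).card := by
  decide

open QuaternionGroup in
/-- `Q₈ × C₂`, `c₀ = (1, z)`: CM set. [folklore] -/
theorem cm_q8 : ∀ x : QuaternionGroup 2 × Multiplicative (ZMod 2),
    x ∈ ({(a 0, Multiplicative.ofAdd 0), (a 1, Multiplicative.ofAdd 0), (a 2, Multiplicative.ofAdd 0),
      (a 3, Multiplicative.ofAdd 1), (xa 0, Multiplicative.ofAdd 0), (xa 1, Multiplicative.ofAdd 1),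
      (xa 2, Multiplicative.ofAdd 1), (xa 3, Multiplicative.ofAdd 1)} :
      Finset (QuaternionGroup 2 × Multiplicative (ZMod 2))) ↔
    (a 0, Multiplicative.ofAdd 1) * x ∉ ({(a 0, Multiplicative.ofAdd 0), (a 1, Multiplicative.ofAdd 0),
      (a 2, Multiplicative.ofAdd 0), (a 3, Multiplicative.ofAdd 1), (xa 0, Multiplicative.ofAdd 0),
      (xa 1, Multiplicative.ofAdd 1), (xa 2, Multiplicative.ofAdd 1), (xa 3, Multiplicative.ofAdd 1)} :
      Finset (QuaternionGroup 2 × Multiplicative (ZMod 2))) := by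
  decide

open QuaternionGroup in
/-- `Q₈ × C₂`, `c₀ = (1, z)`: trivial left stabiliser. [folklore] -/
theorem prim_q8 : ∀ v : QuaternionGroup 2 × Multiplicative (ZMod 2), v ≠ 1 →
    ∃ w : QuaternionGroup 2 × Multiplicative (ZMod 2),
    ¬ (w ∈ ({(a 0, Multiplicative.ofAdd 0), (a 1, Multiplicative.ofAdd 0), (a 2, Multiplicative.ofAdd 0),
      (a 3, Multiplicative.ofAdd 1), (xa 0, Multiplicative.ofAdd 0), (xa 1, Multiplicative.ofAdd 1),
      (xa 2, Multiplicative.ofAdd 1), (xa 3, Multiplicative.ofAdd 1)} :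
      Finset (QuaternionGroup 2 × Multiplicative (ZMod 2))) ↔
      v * w ∈ ({(a 0, Multiplicative.ofAdd 0), (a 1, Multiplicative.ofAdd 0), (a 2, Multiplicative.ofAdd 0),
      (a 3, Multiplicative.ofAdd 1), (xa 0, Multiplicative.ofAdd 0), (xa 1, Multiplicative.ofAdd 1),
      (xa 2, Multiplicative.ofAdd 1), (xa 3, Multiplicative.ofAdd 1)} :
      Finset (QuaternionGroup 2 × Multiplicative (ZMod 2)))) := by
  decide

open QuaternionGroup in
/-- `Q₈ × C₂`, `c₀ = (1, z)`: Weil type `(4,4)` over the fibres of the second projection. [folklore] -/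
theorem bal_q8 : ∀ x : QuaternionGroup 2 × Multiplicative (ZMod 2),
    (Finset.univ.filter fun h : QuaternionGroup 2 × Multiplicative (ZMod 2) =>
      (MonoidHom.snd (QuaternionGroup 2) (Multiplicative (ZMod 2))) h =
        (MonoidHom.snd (QuaternionGroup 2) (Multiplicative (ZMod 2))) x ∧
      h ∈ ({(a 0, Multiplicative.ofAdd 0), (a 1, Multiplicative.ofAdd 0), (a 2, Multiplicative.ofAdd 0),
      (a 3, Multiplicative.ofAdd 1), (xa 0, Multiplicative.ofAdd 0), (xa 1, Multiplicative.ofAdd 1),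
      (xa 2, Multiplicative.ofAdd 1), (xa 3, Multiplicative.ofAdd 1)} :
      Finset (QuaternionGroup 2 × Multiplicative (ZMod 2)))).card =
    (Finset.univ.filter fun h : QuaternionGroup 2 × Multiplicative (ZMod 2) =>
      (MonoidHom.snd (QuaternionGroup 2) (Multiplicative (ZMod 2))) h =
        (MonoidHom.snd (QuaternionGroup 2) (Multiplicative (ZMod 2))) x ∧
      h ∉ ({(a 0, Multiplicative.ofAdd 0), (a 1, Multiplicative.ofAdd 0), (a 2, Multiplicative.ofAdd 0),
      (a 3, Multiplicative.ofAdd 1), (xa 0, Multiplicative.ofAdd 0), (xa 1, Multiplicative.ofAdd 1),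
      (xa 2, Multiplicative.ofAdd 1), (xa 3, Multiplicative.ofAdd 1)} :
      Finset (QuaternionGroup 2 × Multiplicative (ZMod 2)))).card := by
  decide

end Models

/-! ## §3 Simple degenerate CM eightfolds with Galois group `D₄ × C₂` and `Q₈ × C₂` -/

/-- **`Gal(K/ℚ) ≅ D₄ × C₂` with complex conjugation generating the `C₂` factor** — `K = F·k`, `F = K⁺` a totally
real Galois octic with group `D₄`, `k = K^{D₄ × 1}` an imaginary quadratic field: `K` has a PRIMITIVE DEGENERATE CM
type (Weil type `(4,4)` over `k`), realised by a SIMPLE CM abelian eightfold with an exceptional Hodge class on some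
power. [cite: Shimura1998, §6.2 Thm. 3 and §8.2 Prop. 26] [cite: Gordon1999HodgeAVSurvey, Thm. 6.4 and §9.4.3] -/
theorem exists_simple_degenerate_of_equiv_dihedral_prod [IsGalois ℚ K]
    (e : (K ≃ₐ[ℚ] K) ≃* DihedralGroup 4 × Multiplicative (ZMod 2))
    (hc : e ((IsCMField.complexConj K).restrictScalars ℚ) = (DihedralGroup.r 0, Multiplicative.ofAdd 1)) :
    ∃ (Φ : CMType K) (φ₀ : K →+* ℂ) (A : AbelianVariety ℂ) (ι : 𝓞 K →+* End A)
      (θ : K →+* Module.End ℂ (complexBetti A.X 1)),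
      IsPrimitive (ℂ ≃+* ℂ) Φ.1 φ₀ ∧ ¬ IsNondegenerate Φ ∧ IsCMTypeRealisation Φ A ι θ ∧ A.IsSimple ∧
      A.dim = Module.finrank ℚ K / 2 ∧
      ∃ n m : ℕ, ∃ x : complexBetti (⨁ fun _ : Fin n => A).X (2 * m), IsRationalClass x ∧
        IsOfHodgeType (⨁ fun _ : Fin n => A).dim (⨁ fun _ : Fin n => A).X (2 * m) m m x ∧
        x ∉ divisorClassesSpan (⨁ fun _ : Fin n => A).X (⨁ fun _ : Fin n => A).dim m := by
  obtain ⟨φ₀⟩ := (inferInstance : Nonempty (K →+* ℂ))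
  obtain ⟨Φ, hprim, hdeg⟩ := exists_isPrimitive_not_isNondegenerate_of_mulModel e _ hc _ Models.cm_d4
    Models.prim_d4 (MonoidHom.snd _ _) (by decide) Models.bal_d4 φ₀
  obtain ⟨A, ι, θ, hA, hs, hdim⟩ := exists_simple_realisation_of_isPrimitive Φ φ₀ hprim
  exact ⟨Φ, φ₀, A, ι, θ, hprim, hdeg, hA, hs, hdim, exists_exceptional_pow_of_not_isNondegenerate φ₀ hprim hdeg hA⟩

/-- **`Gal(K/ℚ) ≅ Q₈ × C₂` with complex conjugation generating the `C₂` factor** — `K = F·k`, `F` a totally real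
Galois octic with group `Q₈`, `k` imaginary quadratic: a PRIMITIVE DEGENERATE CM type (Weil type `(4,4)` over `k`),
realised by a SIMPLE CM abelian eightfold with an exceptional Hodge class on some power.
[cite: Shimura1998, §6.2 Thm. 3 and §8.2 Prop. 26] [cite: Gordon1999HodgeAVSurvey, Thm. 6.4 and §9.4.3] -/
theorem exists_simple_degenerate_of_equiv_quaternion_prod [IsGalois ℚ K]
    (e : (K ≃ₐ[ℚ] K) ≃* QuaternionGroup 2 × Multiplicative (ZMod 2))
    (hc : e ((IsCMField.complexConj K).restrictScalars ℚ) = (QuaternionGroup.a 0, Multiplicative.ofAdd 1)) :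
    ∃ (Φ : CMType K) (φ₀ : K →+* ℂ) (A : AbelianVariety ℂ) (ι : 𝓞 K →+* End A)
      (θ : K →+* Module.End ℂ (complexBetti A.X 1)),
      IsPrimitive (ℂ ≃+* ℂ) Φ.1 φ₀ ∧ ¬ IsNondegenerate Φ ∧ IsCMTypeRealisation Φ A ι θ ∧ A.IsSimple ∧
      A.dim = Module.finrank ℚ K / 2 ∧
      ∃ n m : ℕ, ∃ x : complexBetti (⨁ fun _ : Fin n => A).X (2 * m), IsRationalClass x ∧
        IsOfHodgeType (⨁ fun _ : Fin n => A).dim (⨁ fun _ : Fin n => A).X (2 * m) m m x ∧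
        x ∉ divisorClassesSpan (⨁ fun _ : Fin n => A).X (⨁ fun _ : Fin n => A).dim m := by
  obtain ⟨φ₀⟩ := (inferInstance : Nonempty (K →+* ℂ))
  obtain ⟨Φ, hprim, hdeg⟩ := exists_isPrimitive_not_isNondegenerate_of_mulModel e _ hc _ Models.cm_q8
    Models.prim_q8 (MonoidHom.snd _ _) (by decide) Models.bal_q8 φ₀
  obtain ⟨A, ι, θ, hA, hs, hdim⟩ := exists_simple_realisation_of_isPrimitive Φ φ₀ hprim
  exact ⟨Φ, φ₀, A, ι, θ, hprim, hdeg, hA, hs, hdim, exists_exceptional_pow_of_not_isNondegenerate φ₀ hprim hdeg hA⟩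

end Summit.HodgeConjecture.CorCM.GaloisSixteenNonabelian

end
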